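import Literature.NumberTheory.ComplexMultiplication.CMTypeQuadraticReflexField
import Literature.NumberTheory.ComplexMultiplication.SexticCMFieldGaloisClosureDichotomy
import HarnessLib

/-!
# How many Galois classes of PRIMITIVE CM types can a CM field have?  `#{primitive classes} · 2(k+1) ≤ 2^g` whenever
# `2^k < 2g` (Ribet (3.1)–(3.2) with Shimura Prop. 28); octic fields: at most TWO (DIS 2022 Rem. 14 is extremal),
# reflex degrees `∈ {2, 4, 6, 8, 12, 16}`; decic fields: at most four, reflex degrees `2` or `≥ 8`

Layer `Literature/NumberTheory/ComplexMultiplication`, namespace `Literature.NumberTheory.ComplexMultiplication` (lane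
`lit-hodgefound`, Track 2 foundations, Layer A3; seat `lit-hodgefound-p11`, generation 25, row g25-#4).  Sequel of
`SexticPrimitiveCMTypesGaloisEquivalent` (g25-#1: Ribet (3.2) in `ℂ`, Cor. 13 = the case `g = 3` of the bound below),
`CMTypeQuadraticReflexField` (g25-#3: the primitive core, reflex degree `2` / `4`), `SexticCMFieldGaloisClosureDichotomy`
(g25-#2: `[ℚ(tr_Φ) : ℚ] ∣ [Kᶜ : ℚ]`), `CMTypeGaloisClassReflexDegree` (g24-#6: a Galois class has `[K* : ℚ]` members),
the tree's `ImprimitivityBound` (`[Kᶜ : ℚ] ∣ 2ⁿ·n!`: `∣ 384` for octic `K`) and `CMTypeGaloisEquivalence` §4 (DIS Rem. 14: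
a cyclic octic field has two Galois classes, all types primitive).  THEOREMS ONLY; no definition, no named fact (D-0026).

THE PRINT.  K. Ribet (1980) §3 (3.1) «`[K : ℚ] = (G : H′) ≤ 2ᵈ`», (3.2) «`1 + Log d ≤ d′ ≤ 2ᵈ⁻¹`» (`(E, S)` simple,
`2d = [E : ℚ]`, `2d′ = [E* : ℚ]`); G. Shimura (1998) §8.3 Prop. 28 (`[K* : ℚ] = [G : H*]` = the number of Galois
translates); B. Dina, S. Ionica, J. Sijsling (2022) §1.2 Cor. 13 («Let `K` be a sextic CM field. Then all primitive CM
types of `K` are Galois equivalent») and Rem. 14 («In genus `4`, it is no longer true that all primitive CM types are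
Galois equivalent. Let `K` be an octic CM field with Galois group `C₈` … the CM types `{0,1,2,3}` and `{0,1,2,6}` are
primitive, yet they are not related»); B. Dodson (1984) §1.1 (Imprimitivity Theorem: `|Gal(Kᶜ/ℚ)| ∣ 2ⁿ·n!`), §5.1.3
Prop. 1 (`n = 5`: partitions `2 + 10 + 10 + 10`, `2 + 10 + 20`, `32` — at most three primitive classes).

THE ARGUMENT.  The Galois classes partition the `2^g` types and the class of `Φ` has `[K*_Φ : ℚ]` members; for a
primitive `Φ`, `2g ≤ 2^{[K*_Φ : ℚ]/2}` (Ribet), so `2^k < 2g` forces `[K*_Φ : ℚ] ≥ 2(k + 1)`; summing over the primitive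
classes gives `#{primitive classes} · 2(k+1) ≤ 2^g`.  `g = 3`: `≤ 8/6`, one class (Cor. 13); `g = 4`: `≤ 16/6`, TWO
classes — attained by `C₈` (Rem. 14); `g = 5`: `≤ 32/8 = 4`.  For octic `K` a primitive reflex degree is even, `≥ 6`,
`≤ 16` and divides `[Kᶜ : ℚ] ∣ 384 = 2⁷·3`, so it is `6, 8, 12` or `16`; an imprimitive octic type has a quadratic or
quartic core, reflex degree `2` or `4`.

WHAT IS PROVED (`K` a CM field, `g = [K : ℚ]/2`).
* §1 `sum_natCard_cmTypeGaloisClass_eq_two_pow` (`Σ_q #q = 2^g`), **`card_classes_subtype_mul_le_two_pow`** (classes all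
  of whose members have reflex degree `≥ m`: `#·m ≤ 2^g`), **`le_finrank_traceField_of_isPrimitive_of_pow_lt`**
  (`2^k < [K : ℚ]`, `Φ` primitive ⟹ `2(k+1) ≤ [K*_Φ : ℚ]`), **`card_primitive_classes_mul_le_two_pow`**
  (`#{primitive Galois classes} · 2(k+1) ≤ 2^g`).
* §2 octic: `six_le_finrank_traceField_of_isPrimitive_octic`, **`card_primitive_classes_le_two_of_finrank_eq_eight`**
  (at most TWO primitive Galois classes), **`card_primitive_classes_eq_two_of_isCyclic_octic`** (Rem. 14: the bound is
  attained by cyclic octic fields), **`finrank_traceField_mem_of_isPrimitive_octic`** (`∈ {6, 8, 12, 16}`),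
  `finrank_traceField_mem_of_not_isPrimitive_octic` (`∈ {2, 4}`), `finrank_traceField_mem_of_finrank_eq_eight`,
  `natCard_galoisClass_mem_of_finrank_eq_eight`, `isPrimitive_iff_six_le_finrank_traceField_octic`.
* §3 decic (`[K : ℚ] = 10`): `eight_le_finrank_traceField_of_isPrimitive_decic`,
  **`card_primitive_classes_le_four_of_finrank_eq_ten`**, `finrank_traceField_eq_two_or_eight_le_of_finrank_eq_ten`.

## References

* [Ribet1980] K. A. Ribet, *Division fields of abelian varieties with complex multiplication*, Mém. SMF (2) 2 (1980),
  §3 (3.1)–(3.2) (p. 85).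
* [Shimura1998] G. Shimura, *Abelian Varieties with Complex Multiplication and Modular Functions* (1998), §8.3 Prop. 28.
* [DinaIonicaSijsling2022] B. Dina, S. Ionica, J. Sijsling, Math. Comp. 91 (2022), §1.2 Def. 8, Cor. 13, Rem. 14.
* [Dodson1984] B. Dodson, Trans. AMS 283 (1984), §1.1 Imprimitivity Theorem, §1.3 Remark, §5.1.3 Proposition 1.

## Provenance

Lane `lit-hodgefound` (HOME `run/shared/lean/pub/lit-hodgefound/`), prover seat `lit-hodgefound-p11` (gen 25),
self-proposed row g25-#4 (INBOX claim 2026-08-27, l.40690).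
-/

set_option autoImplicit false

noncomputable section

open scoped Classical NumberField Pointwise
open NumberField Module IntermediateField

namespace Literature.NumberTheory.ComplexMultiplication

open Literature.AlgebraicGeometry.Motives (CMType)
open Literature.AlgebraicGeometry.Motives.HodgeStructure (cmTypeSmul cmTypeSmul_val)

variable {K : Type} [Field K] [NumberField K] [IsCMField K]

/-! ## §1 Counting over Galois classes -/

section Counting

/-- The fibre of the class map over `⟦Φ₀⟧` is the Galois class of `Φ₀`, with `[K*_{Φ₀} : ℚ]` members (g24-#6).
[cite: Shimura1998, §8.3 Prop. 28] [cite: DinaIonicaSijsling2022, §1.2 Def. 8] -/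
theorem natCard_fiber_cmTypeGaloisClass_eq_finrank_traceField (Φ₀ : CMType K) :
    Nat.card {Φ : CMType K // Quotient.mk (cmTypeGaloisSetoid K) Φ = Quotient.mk (cmTypeGaloisSetoid K) Φ₀} =
      finrank ℚ (traceField Φ₀) := by
  rw [← natCard_galoisClass_eq_finrank_traceField Φ₀]
  exact Nat.card_congr (Equiv.subtypeEquivRight fun Ψ => by rw [eq_comm, cmTypeGaloisClass_eq_iff])

/-- **`Σ_{classes q} #q = 2^g`**: the Galois classes partition the `2^g` CM types. [cite: Ribet1980, §3 (3.1) (p. 85)]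
[cite: DinaIonicaSijsling2022, §1.2 Def. 8] -/
theorem sum_natCard_cmTypeGaloisClass_eq_two_pow [Fintype (Quotient (cmTypeGaloisSetoid K))] :
    ∑ q : Quotient (cmTypeGaloisSetoid K), Nat.card {Φ : CMType K // Quotient.mk (cmTypeGaloisSetoid K) Φ = q} =
      2 ^ (finrank ℚ K / 2) := by
  haveI : Finite (CMType K) := finite_cmType
  let e : CMType K ≃ Σ q : Quotient (cmTypeGaloisSetoid K),
      {Φ : CMType K // Quotient.mk (cmTypeGaloisSetoid K) Φ = q} :=
    { toFun := fun Φ => ⟨Quotient.mk _ Φ, ⟨Φ, rfl⟩⟩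
      invFun := fun x => x.2.1
      left_inv := fun Φ => rfl
      right_inv := fun x => by
        obtain ⟨q, ⟨Φ, hΦ⟩⟩ := x
        subst hΦ
        rfl }
  rw [← CMTypeCount.natCard_cmType (K := K), Nat.card_congr e, Nat.card_sigma]

/-- **If every type with property `P` has reflex degree `≥ m`, the classes consisting of `P`-types number at most
`2^g / m`**: `#{q | all members of q satisfy P} · m ≤ 2^g`. [cite: Ribet1980, §3 (3.1) (p. 85)] [cite: Shimura1998, §8.3 Prop. 28] -/
theorem card_classes_subtype_mul_le_two_pow (P : CMType K → Prop) (m : ℕ)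
    (hm : ∀ Φ : CMType K, P Φ → m ≤ finrank ℚ (traceField Φ)) :
    Nat.card {q : Quotient (cmTypeGaloisSetoid K) // ∀ Φ : CMType K, Quotient.mk _ Φ = q → P Φ} * m ≤
      2 ^ (finrank ℚ K / 2) := by
  classical
  haveI := finite_cmTypeGaloisClasses (K := K)
  letI : Fintype (Quotient (cmTypeGaloisSetoid K)) := Fintype.ofFinite _
  have hfib : ∀ q : Quotient (cmTypeGaloisSetoid K), (∀ Φ : CMType K, Quotient.mk _ Φ = q → P Φ) →
      m ≤ Nat.card {Φ : CMType K // Quotient.mk (cmTypeGaloisSetoid K) Φ = q} := by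
    intro q hq
    obtain ⟨Φ₀, rfl⟩ := Quotient.exists_rep q
    rw [natCard_fiber_cmTypeGaloisClass_eq_finrank_traceField]
    exact hm Φ₀ (hq Φ₀ rfl)
  rw [← sum_natCard_cmTypeGaloisClass_eq_two_pow (K := K), Nat.card_eq_fintype_card, Fintype.card_subtype]
  calc (Finset.univ.filter fun q : Quotient (cmTypeGaloisSetoid K) => ∀ Φ : CMType K, Quotient.mk _ Φ = q → P Φ).card * m
      = ∑ q ∈ Finset.univ.filter (fun q : Quotient (cmTypeGaloisSetoid K) => ∀ Φ : CMType K, Quotient.mk _ Φ = q → P Φ), m := by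
        rw [Finset.sum_const, smul_eq_mul]
    _ ≤ ∑ q ∈ Finset.univ.filter (fun q : Quotient (cmTypeGaloisSetoid K) => ∀ Φ : CMType K, Quotient.mk _ Φ = q → P Φ),
          Nat.card {Φ : CMType K // Quotient.mk (cmTypeGaloisSetoid K) Φ = q} :=
        Finset.sum_le_sum fun q hq => hfib q (Finset.mem_filter.1 hq).2
    _ ≤ ∑ q : Quotient (cmTypeGaloisSetoid K), Nat.card {Φ : CMType K // Quotient.mk (cmTypeGaloisSetoid K) Φ = q} :=
        Finset.sum_le_sum_of_subset_of_nonneg (Finset.filter_subset _ _) fun _ _ _ => Nat.zero_le _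

/-- **Ribet (3.2), quantified: `2^k < [K : ℚ]` and `Φ` primitive ⟹ `[K*_Φ : ℚ] ≥ 2(k + 1)`** (`[K : ℚ] ≤ 2^{[K* : ℚ]/2}`
and the reflex degree is even). [cite: Ribet1980, §3 (3.2) (p. 85)] -/
theorem le_finrank_traceField_of_isPrimitive_of_pow_lt {k : ℕ} (hk : 2 ^ k < finrank ℚ K) {Φ : CMType K}
    {φ₀ : K →+* ℂ} (hprim : IsPrimitive (ℂ ≃+* ℂ) Φ.1 φ₀) : 2 * (k + 1) ≤ finrank ℚ (traceField Φ) := by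
  have h := finrank_le_two_pow_of_isPrimitive_complex hprim
  obtain ⟨m, hm⟩ := two_dvd_finrank_traceField Φ
  rw [hm, Nat.mul_div_cancel_left _ two_pos] at h
  rw [hm]
  by_contra hlt
  have hmk : m ≤ k := by omega
  have := Nat.pow_le_pow_right two_pos hmk
  omega

/-- **`#{primitive Galois classes} · 2(k+1) ≤ 2^g` whenever `2^k < [K : ℚ]`** (primitive = not induced from a CM type of
a strict subfield; the class of a primitive type consists of primitive types).  `g = 3`: one class (DIS Cor. 13, g25-#1
`card_cmTypeGaloisClasses_not_induced_le_one`); `g = 4`: two; `g = 5`: four. [cite: Ribet1980, §3 (3.1)–(3.2) (p. 85)]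
[cite: Shimura1998, §8.3 Prop. 28] [cite: DinaIonicaSijsling2022, §1.2 Cor. 13 and Rem. 14] -/
theorem card_primitive_classes_mul_le_two_pow {k : ℕ} (hk : 2 ^ k < finrank ℚ K) :
    Nat.card {q : Quotient (cmTypeGaloisSetoid K) // ∀ Φ : CMType K, Quotient.mk _ Φ = q →
        ¬ ∃ (k' : IntermediateField ℚ K) (Ψ : CMType k'), k' ≠ ⊤ ∧ inducedCMType (algebraMap k' K) Ψ = Φ} *
      (2 * (k + 1)) ≤ 2 ^ (finrank ℚ K / 2) := by
  obtain ⟨φ₀⟩ := (inferInstance : Nonempty (K →+* ℂ))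
  exact card_classes_subtype_mul_le_two_pow _ _ fun Φ hΦ =>
    le_finrank_traceField_of_isPrimitive_of_pow_lt hk ((SiegelCMPoint.not_exists_inducedCMType_iff_isPrimitive Φ φ₀).1 hΦ)

end Counting

/-! ## §2 Octic CM fields: at most two primitive Galois classes; reflex degrees `2, 4 | 6, 8, 12, 16` -/

section Octic

/-- **A primitive type of an OCTIC CM field has reflex degree `≥ 6`** (`8 ≤ 2^{[K* : ℚ]/2}`). [cite: Ribet1980, §3 (3.2) (p. 85)] -/
theorem six_le_finrank_traceField_of_isPrimitive_octic (h8 : finrank ℚ K = 8) {Φ : CMType K} {φ₀ : K →+* ℂ}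
    (hprim : IsPrimitive (ℂ ≃+* ℂ) Φ.1 φ₀) : 6 ≤ finrank ℚ (traceField Φ) :=
  le_finrank_traceField_of_isPrimitive_of_pow_lt (k := 2) (by rw [h8]; norm_num) hprim

/-- **An octic CM field has AT MOST TWO Galois classes of primitive CM types** (`#·6 ≤ 16`; DIS Rem. 14 shows two occur).
[cite: Ribet1980, §3 (3.1)–(3.2) (p. 85)] [cite: DinaIonicaSijsling2022, §1.2 Rem. 14] -/
theorem card_primitive_classes_le_two_of_finrank_eq_eight (h8 : finrank ℚ K = 8) :
    Nat.card {q : Quotient (cmTypeGaloisSetoid K) // ∀ Φ : CMType K, Quotient.mk _ Φ = q →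
        ¬ ∃ (k' : IntermediateField ℚ K) (Ψ : CMType k'), k' ≠ ⊤ ∧ inducedCMType (algebraMap k' K) Ψ = Φ} ≤ 2 := by
  have h := card_primitive_classes_mul_le_two_pow (K := K) (k := 2) (by rw [h8]; norm_num)
  rw [h8, show (2 : ℕ) ^ (8 / 2) = 16 from by norm_num, show 2 * (2 + 1) = 6 from rfl] at h
  omega

/-- **DIS REM. 14 IS EXTREMAL: a cyclic octic CM field has exactly TWO primitive Galois classes** (all `16` types are
primitive and there are two Galois classes, tree `CMTypeGaloisEquivalence` §4 / `CMTypeEquivalenceClassesCount` §10).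
[cite: DinaIonicaSijsling2022, §1.2 Rem. 14] -/
theorem card_primitive_classes_eq_two_of_isCyclic_octic [IsGalois ℚ K] (hcyc : IsCyclic (K ≃ₐ[ℚ] K))
    (h8 : finrank ℚ K = 8) :
    Nat.card {q : Quotient (cmTypeGaloisSetoid K) // ∀ Φ : CMType K, Quotient.mk _ Φ = q →
        ¬ ∃ (k' : IntermediateField ℚ K) (Ψ : CMType k'), k' ≠ ⊤ ∧ inducedCMType (algebraMap k' K) Ψ = Φ} = 2 := by
  rw [← card_cmTypeGaloisClasses_eq_two_of_finrank_eq_eight hcyc h8]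
  exact Nat.card_congr (Equiv.subtypeUnivEquiv fun q Φ _ => not_exists_inducedCMType_of_finrank_eq_eight hcyc h8 Φ)

/-- **The reflex degree of a PRIMITIVE octic type is `6, 8, 12` or `16`**: even, `≥ 6`, `≤ 2⁴`, and a divisor of
`[Kᶜ : ℚ] ∣ 2⁴·4! = 384` (so `10` and `14` do not occur). [cite: Ribet1980, §3 (3.1)–(3.2) (p. 85)]
[cite: Dodson1984, §1.1 Imprimitivity Theorem and §1.3 Remark] -/
theorem finrank_traceField_mem_of_isPrimitive_octic (h8 : finrank ℚ K = 8) {Φ : CMType K} {φ₀ : K →+* ℂ}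
    (hprim : IsPrimitive (ℂ ≃+* ℂ) Φ.1 φ₀) :
    finrank ℚ (traceField Φ) = 6 ∨ finrank ℚ (traceField Φ) = 8 ∨ finrank ℚ (traceField Φ) = 12 ∨
      finrank ℚ (traceField Φ) = 16 := by
  -- the normal closure of `K` inside `ℂ`
  let C : IntermediateField ℚ ℂ := normalClosure ℚ K ℂ
  haveI : IsNormalClosure ℚ K C := Algebra.IsAlgebraic.isNormalClosure_normalClosure fun x => IsAlgClosed.splits _
  haveI : NumberField C := NumberField.mk
  haveI : IsCMField C := isCMField_of_isNormalClosure (K := K) (L := C)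
  have hdvd : finrank ℚ (traceField Φ) ∣ 384 :=
    (finrank_traceField_dvd_finrank_normalClosure (L := C) Φ).trans (finrank_dvd_384_of_octic_cm (L := C) K h8)
  have h6 := six_le_finrank_traceField_of_isPrimitive_octic h8 hprim
  have h16 := finrank_traceField_le_two_pow Φ
  rw [h8] at h16
  norm_num at h16
  obtain ⟨m, hm⟩ := two_dvd_finrank_traceField Φ
  rw [hm] at hdvd h6 h16 ⊢
  have hm3 : 3 ≤ m := by omega
  have hm8 : m ≤ 8 := by omega
  interval_cases m <;> omega

/-- **The reflex degree of an IMPRIMITIVE octic type is `2` or `4`**: it is induced from a strict CM subfield of degree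
`2` (reflex degree `2`) or `4` (reflex degree `4` for a primitive quartic type, `2` for an imprimitive one).
[cite: Shimura1998, §8.3 (after Prop. 28) and §8.4 Example (2)] [cite: Streng2010, Ch. I Lemma 3.4 and Lemma 3.5] -/
theorem finrank_traceField_mem_of_not_isPrimitive_octic (h8 : finrank ℚ K = 8) {Φ : CMType K} {φ₀ : K →+* ℂ}
    (h : ¬ IsPrimitive (ℂ ≃+* ℂ) Φ.1 φ₀) : finrank ℚ (traceField Φ) = 2 ∨ finrank ℚ (traceField Φ) = 4 := by
  rw [← SiegelCMPoint.not_exists_inducedCMType_iff_isPrimitive Φ φ₀, not_not] at h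
  obtain ⟨k, Ψ, hk, rfl⟩ := h
  haveI : NumberField k := NumberField.mk
  haveI : IsCMField k := isCMField_of_cmType_intermediateField k Ψ
  -- `[k : ℚ]` is even, divides `8`, is not `8`: it is `2` or `4`
  have hdvd : finrank ℚ k ∣ 2 ^ 3 := by
    rw [show (2 : ℕ) ^ 3 = finrank ℚ K by rw [h8]; norm_num]
    exact ⟨_, (Module.finrank_mul_finrank ℚ k K).symm⟩
  obtain ⟨a, ha, hka⟩ := (Nat.dvd_prime_pow Nat.prime_two).1 hdvd
  have hne : finrank ℚ k ≠ 8 := fun h8' =>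
    hk (IntermediateField.eq_of_le_of_finrank_eq le_top (by rw [h8', IntermediateField.finrank_top', h8]))
  have hge := two_le_finrank_of_cmType Ψ
  have hk24 : finrank ℚ k = 2 ∨ finrank ℚ k = 4 := by
    rw [hka] at hne hge ⊢
    interval_cases a <;> simp_all
  rw [traceField_inducedCMType_ringHom]
  rcases hk24 with hk2 | hk4
  · exact Or.inl (finrank_traceField_eq_two_of_finrank_eq_two hk2 Ψ)
  · obtain ⟨s₀⟩ := (inferInstance : Nonempty (k →+* ℂ))
    by_cases hP : IsPrimitive (ℂ ≃+* ℂ) Ψ.1 s₀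
    · exact Or.inr (finrank_traceField_eq_four_of_isPrimitive hk4 hP)
    · exact Or.inl (finrank_traceField_eq_two_of_not_isPrimitive hk4 hP)

/-- **Octic CM field: every reflex degree is `2, 4, 6, 8, 12` or `16`.** [cite: Ribet1980, §3 (3.1)–(3.2) (p. 85)]
[cite: Dodson1984, §1.1 and §1.3] [cite: Shimura1998, §8.3 Prop. 28] -/
theorem finrank_traceField_mem_of_finrank_eq_eight (h8 : finrank ℚ K = 8) (Φ : CMType K) :
    finrank ℚ (traceField Φ) = 2 ∨ finrank ℚ (traceField Φ) = 4 ∨ finrank ℚ (traceField Φ) = 6 ∨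
      finrank ℚ (traceField Φ) = 8 ∨ finrank ℚ (traceField Φ) = 12 ∨ finrank ℚ (traceField Φ) = 16 := by
  obtain ⟨φ₀⟩ := (inferInstance : Nonempty (K →+* ℂ))
  by_cases h : IsPrimitive (ℂ ≃+* ℂ) Φ.1 φ₀
  · rcases finrank_traceField_mem_of_isPrimitive_octic h8 h with h' | h' | h' | h' <;> omega
  · rcases finrank_traceField_mem_of_not_isPrimitive_octic h8 h with h' | h' <;> omega

/-- … equivalently every Galois class of an octic CM field has `2, 4, 6, 8, 12` or `16` members.
[cite: Shimura1998, §8.3 Prop. 28] [cite: DinaIonicaSijsling2022, §1.2 Def. 8 and Rem. 14] -/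
theorem natCard_galoisClass_mem_of_finrank_eq_eight (h8 : finrank ℚ K = 8) (Φ : CMType K) :
    Nat.card {Ψ : CMType K // ∃ τ : ℂ ≃+* ℂ, Ψ = cmTypeSmul τ Φ} ∈ ({2, 4, 6, 8, 12, 16} : Set ℕ) := by
  rw [natCard_galoisClass_eq_finrank_traceField]
  simp only [Set.mem_insert_iff, Set.mem_singleton_iff]
  exact finrank_traceField_mem_of_finrank_eq_eight h8 Φ

/-- Octic: `Φ` is primitive `⟺ [K*_Φ : ℚ] ≥ 6` (imprimitive types have reflex degree `≤ 4`).
[cite: Ribet1980, §3 (3.2) (p. 85)] [cite: Shimura1998, §8.2 Prop. 26 and §8.3 Prop. 28] -/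
theorem isPrimitive_iff_six_le_finrank_traceField_octic (h8 : finrank ℚ K = 8) (Φ : CMType K) (φ₀ : K →+* ℂ) :
    IsPrimitive (ℂ ≃+* ℂ) Φ.1 φ₀ ↔ 6 ≤ finrank ℚ (traceField Φ) := by
  constructor
  · exact six_le_finrank_traceField_of_isPrimitive_octic h8
  · intro h6
    by_contra h
    rcases finrank_traceField_mem_of_not_isPrimitive_octic h8 h with h' | h' <;> omega

/-- Octic: primitivity does not depend on the base embedding. [cite: Shimura1998, §8.2 Prop. 26] -/
theorem isPrimitive_iff_isPrimitive_of_finrank_eq_eight (h8 : finrank ℚ K = 8) (Φ : CMType K) (φ₀ φ₁ : K →+* ℂ) :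
    IsPrimitive (ℂ ≃+* ℂ) Φ.1 φ₀ ↔ IsPrimitive (ℂ ≃+* ℂ) Φ.1 φ₁ := by
  rw [isPrimitive_iff_six_le_finrank_traceField_octic h8 Φ φ₀, isPrimitive_iff_six_le_finrank_traceField_octic h8 Φ φ₁]

/-- Octic: two primitive types whose reflex degrees add up to more than `16` are Galois equivalent (e.g. one of reflex
degree `12` is equivalent to every other primitive type). [cite: Ribet1980, §3 (3.1) (p. 85)] [cite: Shimura1998, §8.3 Prop. 28] -/
theorem galoisRel_of_finrank_traceField_eq_twelve_octic (h8 : finrank ℚ K = 8) {Φ Ψ : CMType K} {φ₀ : K →+* ℂ}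
    (hΦ : finrank ℚ (traceField Φ) = 12) (hΨ : IsPrimitive (ℂ ≃+* ℂ) Ψ.1 φ₀) : (cmTypeGaloisSetoid K).r Φ Ψ := by
  refine rel_of_two_pow_lt_add ?_
  have h := six_le_finrank_traceField_of_isPrimitive_octic h8 hΨ
  rw [h8, hΦ]
  norm_num
  omega

end Octic

/-! ## §3 Decic CM fields (`n = 5`): at most four primitive Galois classes; reflex degrees `2` or `≥ 8` -/

section Decic

/-- **A primitive type of a CM field of degree `10` has reflex degree `≥ 8`** (`10 ≤ 2^{[K* : ℚ]/2}`).
[cite: Ribet1980, §3 (3.2) (p. 85)] [cite: Dodson1984, §5.1.3 Proposition 1] -/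
theorem eight_le_finrank_traceField_of_isPrimitive_decic (h10 : finrank ℚ K = 10) {Φ : CMType K} {φ₀ : K →+* ℂ}
    (hprim : IsPrimitive (ℂ ≃+* ℂ) Φ.1 φ₀) : 8 ≤ finrank ℚ (traceField Φ) :=
  le_finrank_traceField_of_isPrimitive_of_pow_lt (k := 3) (by rw [h10]; norm_num) hprim

/-- **A CM field of degree `10` has at most FOUR Galois classes of primitive types** (`#·8 ≤ 32`; Dodson's partitions
`2 + 10 + 10 + 10`, `2 + 10 + 20`, `32` show `3, 2, 1`). [cite: Ribet1980, §3 (3.1)–(3.2) (p. 85)]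
[cite: Dodson1984, §5.1.3 Proposition 1] -/
theorem card_primitive_classes_le_four_of_finrank_eq_ten (h10 : finrank ℚ K = 10) :
    Nat.card {q : Quotient (cmTypeGaloisSetoid K) // ∀ Φ : CMType K, Quotient.mk _ Φ = q →
        ¬ ∃ (k' : IntermediateField ℚ K) (Ψ : CMType k'), k' ≠ ⊤ ∧ inducedCMType (algebraMap k' K) Ψ = Φ} ≤ 4 := by
  have h := card_primitive_classes_mul_le_two_pow (K := K) (k := 3) (by rw [h10]; norm_num)
  rw [h10, show (2 : ℕ) ^ (10 / 2) = 32 from by norm_num, show 2 * (3 + 1) = 8 from rfl] at h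
  omega

/-- **Degree `10`: every reflex degree is `2` (imprimitive: induced from the imaginary quadratic subfield, g25-#3) or
`≥ 8` (primitive).** [cite: Dodson1984, §5.1.3 Proposition 1] [cite: Ribet1980, §3 (3.2) (p. 85)] -/
theorem finrank_traceField_eq_two_or_eight_le_of_finrank_eq_ten (h10 : finrank ℚ K = 10) (Φ : CMType K) :
    finrank ℚ (traceField Φ) = 2 ∨ 8 ≤ finrank ℚ (traceField Φ) := by
  obtain ⟨φ₀⟩ := (inferInstance : Nonempty (K →+* ℂ))
  by_cases h : IsPrimitive (ℂ ≃+* ℂ) Φ.1 φ₀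
  · exact Or.inr (eight_le_finrank_traceField_of_isPrimitive_decic h10 h)
  · exact Or.inl ((not_isPrimitive_iff_finrank_traceField_eq_two_of_prime Nat.prime_five h10 Φ φ₀).1 h)

/-- Degree `10`: `Φ` is primitive `⟺ [K*_Φ : ℚ] ≥ 8`. [cite: Ribet1980, §3 (3.2) (p. 85)] [cite: Dodson1984, §5.1.3 Proposition 1] -/
theorem isPrimitive_iff_eight_le_finrank_traceField_decic (h10 : finrank ℚ K = 10) (Φ : CMType K) (φ₀ : K →+* ℂ) :
    IsPrimitive (ℂ ≃+* ℂ) Φ.1 φ₀ ↔ 8 ≤ finrank ℚ (traceField Φ) := by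
  constructor
  · exact eight_le_finrank_traceField_of_isPrimitive_decic h10
  · intro h8
    by_contra h
    have h2 := (not_isPrimitive_iff_finrank_traceField_eq_two_of_prime Nat.prime_five h10 Φ φ₀).1 h
    omega

end Decic

end Literature.NumberTheory.ComplexMultiplication
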